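import Mathlib.Analysis.SpecialFunctions.Pow.Real
import Mathlib.Analysis.SpecialFunctions.Sqrt

/-!
# The ring `ℤ[α]`, `α⁴ = 2` (`α = 2^{1/4}`), with its embedding into `ℝ`

Framing: lottery ticket; floor = certified bounds/negative ranges. Venture `PackingBounds` (cell
`pub-packcert`, seat `pub-packcert-recog`). A small computable model of the order `ℤ[α]`, `α = 2^{1/4}`:
quadruples `⟨a, b, c, d⟩ ↔ a + bα + cα² + dα³` with the multiplication reduced by `α⁴ = 2`, a `CommRing`
instance with decidable equality (for the `decide` checks of `Configurations/ListConfig.lean`), the real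
fourth root `alpha = √(√2)` (`alpha ^ 4 = 2`, `alpha ^ 2 = √2`, `1.189207 < alpha < 1.189208`) and the ring
homomorphism `toReal : QuarticTwoInt →+* ℝ`. Used by `Configurations/SquareAntiprism.lean` (Tammes `N = 8`:
the square antiprism has coordinates in `ℤ[2^{1/4}]`, its cosine `(2√2 - 1)/7` lies in `ℤ[√2] ⊂ ℤ[α]`).
Same construction as `TribonacciInt.lean` / Mathlib's `Zsqrtd`.
-/

namespace Summit.Ventures.PackingBounds.Config

/-- Elements `a + bα + cα² + dα³` of `ℤ[α]`, `α⁴ = 2`. -/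
@[ext]
structure QuarticTwoInt where
  /-- coefficient of `1` -/
  c0 : ℤ
  /-- coefficient of `α` -/
  c1 : ℤ
  /-- coefficient of `α²` -/
  c2 : ℤ
  /-- coefficient of `α³` -/
  c3 : ℤ
  deriving DecidableEq, Repr

namespace QuarticTwoInt

/-- The image of an integer. -/
def ofInt (n : ℤ) : QuarticTwoInt := ⟨n, 0, 0, 0⟩

/-- Zero. -/
instance : Zero QuarticTwoInt := ⟨ofInt 0⟩

/-- One. -/
instance : One QuarticTwoInt := ⟨ofInt 1⟩

/-- The generator `α` (`α⁴ = 2`). -/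
def α : QuarticTwoInt := ⟨0, 1, 0, 0⟩

/-- Default element `0`. -/
instance : Inhabited QuarticTwoInt := ⟨0⟩

/-- Componentwise addition. -/
instance : Add QuarticTwoInt := ⟨fun x y => ⟨x.c0 + y.c0, x.c1 + y.c1, x.c2 + y.c2, x.c3 + y.c3⟩⟩

/-- Componentwise negation. -/
instance : Neg QuarticTwoInt := ⟨fun x => ⟨-x.c0, -x.c1, -x.c2, -x.c3⟩⟩

/-- Multiplication, reduced by `α⁴ = 2`, `α⁵ = 2α`, `α⁶ = 2α²`. -/
instance : Mul QuarticTwoInt := ⟨fun x y =>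
  ⟨x.c0 * y.c0 + 2 * (x.c1 * y.c3 + x.c2 * y.c2 + x.c3 * y.c1),
   x.c0 * y.c1 + x.c1 * y.c0 + 2 * (x.c2 * y.c3 + x.c3 * y.c2),
   x.c0 * y.c2 + x.c1 * y.c1 + x.c2 * y.c0 + 2 * (x.c3 * y.c3),
   x.c0 * y.c3 + x.c1 * y.c2 + x.c2 * y.c1 + x.c3 * y.c0⟩⟩

/-- Component `c0` of `0`. -/
@[simp] theorem zero_c0 : (0 : QuarticTwoInt).c0 = 0 := rfl
/-- Component `c1` of `0`. -/
@[simp] theorem zero_c1 : (0 : QuarticTwoInt).c1 = 0 := rfl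
/-- Component `c2` of `0`. -/
@[simp] theorem zero_c2 : (0 : QuarticTwoInt).c2 = 0 := rfl
/-- Component `c3` of `0`. -/
@[simp] theorem zero_c3 : (0 : QuarticTwoInt).c3 = 0 := rfl
/-- Component `c0` of `1`. -/
@[simp] theorem one_c0 : (1 : QuarticTwoInt).c0 = 1 := rfl
/-- Component `c1` of `1`. -/
@[simp] theorem one_c1 : (1 : QuarticTwoInt).c1 = 0 := rfl
/-- Component `c2` of `1`. -/
@[simp] theorem one_c2 : (1 : QuarticTwoInt).c2 = 0 := rfl
/-- Component `c3` of `1`. -/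
@[simp] theorem one_c3 : (1 : QuarticTwoInt).c3 = 0 := rfl
/-- Component `c0` of a sum. -/
@[simp] theorem add_c0 (x y : QuarticTwoInt) : (x + y).c0 = x.c0 + y.c0 := rfl
/-- Component `c1` of a sum. -/
@[simp] theorem add_c1 (x y : QuarticTwoInt) : (x + y).c1 = x.c1 + y.c1 := rfl
/-- Component `c2` of a sum. -/
@[simp] theorem add_c2 (x y : QuarticTwoInt) : (x + y).c2 = x.c2 + y.c2 := rfl
/-- Component `c3` of a sum. -/
@[simp] theorem add_c3 (x y : QuarticTwoInt) : (x + y).c3 = x.c3 + y.c3 := rfl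
/-- Component `c0` of a negation. -/
@[simp] theorem neg_c0 (x : QuarticTwoInt) : (-x).c0 = -x.c0 := rfl
/-- Component `c1` of a negation. -/
@[simp] theorem neg_c1 (x : QuarticTwoInt) : (-x).c1 = -x.c1 := rfl
/-- Component `c2` of a negation. -/
@[simp] theorem neg_c2 (x : QuarticTwoInt) : (-x).c2 = -x.c2 := rfl
/-- Component `c3` of a negation. -/
@[simp] theorem neg_c3 (x : QuarticTwoInt) : (-x).c3 = -x.c3 := rfl
/-- Component `c0` of a product. -/
@[simp] theorem mul_c0 (x y : QuarticTwoInt) :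
    (x * y).c0 = x.c0 * y.c0 + 2 * (x.c1 * y.c3 + x.c2 * y.c2 + x.c3 * y.c1) := rfl
/-- Component `c1` of a product. -/
@[simp] theorem mul_c1 (x y : QuarticTwoInt) :
    (x * y).c1 = x.c0 * y.c1 + x.c1 * y.c0 + 2 * (x.c2 * y.c3 + x.c3 * y.c2) := rfl
/-- Component `c2` of a product. -/
@[simp] theorem mul_c2 (x y : QuarticTwoInt) :
    (x * y).c2 = x.c0 * y.c2 + x.c1 * y.c1 + x.c2 * y.c0 + 2 * (x.c3 * y.c3) := rfl
/-- Component `c3` of a product. -/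
@[simp] theorem mul_c3 (x y : QuarticTwoInt) :
    (x * y).c3 = x.c0 * y.c3 + x.c1 * y.c2 + x.c2 * y.c1 + x.c3 * y.c0 := rfl

/-- Additive group structure (componentwise). -/
instance addCommGroup : AddCommGroup QuarticTwoInt := by
  refine
  { sub := fun a b => a + -b
    nsmul := @nsmulRec QuarticTwoInt ⟨0⟩ ⟨(· + ·)⟩
    zsmul := @zsmulRec QuarticTwoInt ⟨0⟩ ⟨(· + ·)⟩ ⟨Neg.neg⟩ (@nsmulRec QuarticTwoInt ⟨0⟩ ⟨(· + ·)⟩)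
    add_assoc := ?_
    zero_add := ?_
    add_zero := ?_
    neg_add_cancel := ?_
    add_comm := ?_ } <;>
  intros <;>
  ext <;>
  simp [add_comm, add_left_comm]

/-- Component `c0` of a difference. -/
@[simp] theorem sub_c0 (x y : QuarticTwoInt) : (x - y).c0 = x.c0 - y.c0 := by
  change (x + -y).c0 = _; simp [sub_eq_add_neg]
/-- Component `c1` of a difference. -/
@[simp] theorem sub_c1 (x y : QuarticTwoInt) : (x - y).c1 = x.c1 - y.c1 := by
  change (x + -y).c1 = _; simp [sub_eq_add_neg]
/-- Component `c2` of a difference. -/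
@[simp] theorem sub_c2 (x y : QuarticTwoInt) : (x - y).c2 = x.c2 - y.c2 := by
  change (x + -y).c2 = _; simp [sub_eq_add_neg]
/-- Component `c3` of a difference. -/
@[simp] theorem sub_c3 (x y : QuarticTwoInt) : (x - y).c3 = x.c3 - y.c3 := by
  change (x + -y).c3 = _; simp [sub_eq_add_neg]

/-- Casts of naturals and integers. -/
instance addGroupWithOne : AddGroupWithOne QuarticTwoInt :=
  { QuarticTwoInt.addCommGroup with
    natCast := fun n => ofInt n
    intCast := ofInt }

/-- `ℤ[α]` is a commutative ring. -/
instance commRing : CommRing QuarticTwoInt := by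
  refine
  { QuarticTwoInt.addGroupWithOne with
    npow := @npowRec QuarticTwoInt ⟨1⟩ ⟨(· * ·)⟩,
    add_comm := ?_
    left_distrib := ?_
    right_distrib := ?_
    zero_mul := ?_
    mul_zero := ?_
    mul_assoc := ?_
    one_mul := ?_
    mul_one := ?_
    mul_comm := ?_ } <;>
  intros <;>
  ext <;>
  simp <;>
  ring

/-- `α⁴ = 2` in `ℤ[α]` (sanity check of the multiplication table). -/
theorem α_pow_four : α * α * α * α = 2 := by decide

/-! ### The real fourth root of `2` and the embedding -/

/-- `alpha = 2^{1/4} = √(√2) = 1.18920711…`. -/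
noncomputable def alpha : ℝ := Real.sqrt (Real.sqrt 2)

/-- `alpha² = √2`. -/
theorem alpha_sq : alpha ^ 2 = Real.sqrt 2 := by
  rw [alpha, Real.sq_sqrt (Real.sqrt_nonneg 2)]

/-- `alpha⁴ = 2`. -/
theorem alpha_pow_four : alpha ^ 4 = 2 := by
  rw [show alpha ^ 4 = (alpha ^ 2) ^ 2 by ring, alpha_sq, Real.sq_sqrt (by norm_num)]

/-- `0 < alpha`. -/
theorem alpha_pos : 0 < alpha :=
  Real.sqrt_pos.2 (Real.sqrt_pos.2 (by norm_num))

/-- Lower enclosure `1.189207 < alpha`. -/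
theorem alpha_gt : (1.189207 : ℝ) < alpha := by
  have h4 := alpha_pow_four
  have hp := alpha_pos
  by_contra h
  push Not at h
  have h2 : alpha ^ 2 ≤ 1.189207 ^ 2 := by nlinarith
  have h4' : alpha ^ 4 ≤ 1.189207 ^ 4 := by nlinarith
  norm_num at h4'
  linarith

/-- Upper enclosure `alpha < 1.189208`. -/
theorem alpha_lt : alpha < (1.189208 : ℝ) := by
  have h4 := alpha_pow_four
  have hp := alpha_pos
  by_contra h
  push Not at h
  have h2 : 1.189208 ^ 2 ≤ alpha ^ 2 := by nlinarith
  have h4' : 1.189208 ^ 4 ≤ alpha ^ 4 := by nlinarith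
  norm_num at h4'
  linarith

/-- The embedding `ℤ[α] →+* ℝ`, `⟨a, b, c, d⟩ ↦ a + b·alpha + c·alpha² + d·alpha³`. -/
noncomputable def toReal : QuarticTwoInt →+* ℝ where
  toFun x := (x.c0 : ℝ) + x.c1 * alpha + x.c2 * alpha ^ 2 + x.c3 * alpha ^ 3
  map_one' := by simp
  map_mul' := by
    intro x y
    simp only [mul_c0, mul_c1, mul_c2, mul_c3]
    push_cast
    have h := alpha_pow_four
    linear_combination (-(↑x.c1 * ↑y.c3 + ↑x.c2 * ↑y.c2 + ↑x.c3 * ↑y.c1 +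
      (↑x.c2 * ↑y.c3 + ↑x.c3 * ↑y.c2) * alpha + ↑x.c3 * ↑y.c3 * alpha ^ 2)) * h
  map_zero' := by simp
  map_add' := by
    intro x y
    simp only [add_c0, add_c1, add_c2, add_c3]
    push_cast
    ring

/-- Evaluation of the embedding. -/
@[simp] theorem toReal_apply (x : QuarticTwoInt) :
    toReal x = (x.c0 : ℝ) + x.c1 * alpha + x.c2 * alpha ^ 2 + x.c3 * alpha ^ 3 := rfl

end QuarticTwoInt

end Summit.Ventures.PackingBounds.Config
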